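import Literature.NumberTheory.GaussSums.JacobiSumTeichmullerPadicProofs
import Literature.NumberTheory.EllipticCurves.Kato2004.SemilocalDecompositionProofs
import HarnessLib

/-!
# Jacobi sums of Teichmüller powers with values in `ℤ_p`: the integral characters `ω̃ᵗ`, their congruence
# `ω̃(a)ᵗ ≡ aᵗ (mod p)`, and Stickelberger's unit / valuation-one dichotomy read in `ℤ_p`

Topic `Literature/NumberTheory/GaussSums`, namespace `Literature.NumberTheory.GaussSums` (sequel of
`JacobiSumTeichmullerPadicProofs`, which proves, for `ℚ_p`-valued characters `χᵢ ≡ a ↦ a^{tᵢ} (mod p)`,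
`‖J(χ₁,χ₂)‖_p = 1` if `t₁ + t₂ > p − 1` and `= p⁻¹` if `t₁ + t₂ < p − 1` [Lang1990, Ch. 1 §2 Thm. 2.1]).  THEOREMS
ONLY (no definition, no named fact, no instance, no notation, no `sorry`).

Here the characters are the INTEGRAL Teichmüller powers `MulChar.ofUnitHom (ω̃ᵗ) : MulChar (ℤ/p) ℤ_p` built from
the tree's Teichmüller character `Literature.NumberTheory.EllipticCurves.Kato2004.teichmullerChar p : 𝔽_pˣ →* ℤ_pˣ`
(`toZMod_teichmullerChar : ω̃(a) ≡ a`), as they occur as the diagonal characters of the tame principal-series types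
`Fun_{ℤ_p}(Ind(ω̃ⁱ ⊗ ω̃ʲ))` (`Literature/RepresentationTheory/FiniteGroups/GL2ModularPrincipalSeries*`):

* `teichmullerChar_pow_card_sub_one` (`ω̃^{p−1} = 1` as a character), `ofUnitHom_mul_ofUnitHom`,
  `ofUnitHom_teichmullerChar_pow_apply`;
* `norm_teichmullerChar_pow_sub_natCast_pow_lt_one` — `‖ω̃(a)ᵗ − ãᵗ‖ < 1` (`ã = a.val`);
  `norm_ringHomComp_ofUnitHom_teichmullerChar_pow_sub_lt_one` — the hypothesis shape of
  `norm_jacobiSum_eq_one_of_lt_add` / `…_eq_inv_of_add_lt` for `(ofUnitHom ω̃ᵗ)` pushed to `ℚ_p`;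
* **`isUnit_jacobiSum_ofUnitHom_teichmullerChar_pow`** — `tᵢ ≤ p − 2`, `p − 1 < t₁ + t₂` ⟹
  `J(ω̃^{t₁}, ω̃^{t₂}) ∈ ℤ_pˣ`; **`norm_jacobiSum_ofUnitHom_teichmullerChar_pow_eq_inv`** — `1 ≤ tᵢ`, `t₁ + t₂ < p − 1`,
  `(p−1) ∤ tᵢ, t₁+t₂` ⟹ `‖J‖ = p⁻¹` (so `p ∣ J`, `J ∉ ℤ_pˣ`);
* the QUADRATIC-TWIST instances used by the twisting operator of the tame type (`χ = ω̃^{(p−1)/2}` the quadratic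
  character, `θ = ω̃ᵇ`): **`isUnit_jacobiSum_teichmuller_quadratic_of_two_mul_lt`** — for `0 < b`, `2b < p − 1`,
  `J(ω̃ᵇ·χ, χ)` is a unit; **`not_isUnit_jacobiSum_teichmuller_quadratic_of_lt_two_mul`** — for `p − 1 < 2b`,
  `b < p − 1`, it is NOT (Stickelberger exponent `b + (p−1)/2` vs. `p − 1`).
-/

noncomputable section

namespace Literature.NumberTheory.GaussSums

open Literature.NumberTheory.EllipticCurves (Kato2004.teichmullerChar Kato2004.toZMod_teichmullerChar
  Kato2004.teichmullerChar_pow_sub_one Kato2004.teichmullerChar_injective)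

variable (p : ℕ) [hp : Fact p.Prime]

/-! ## The integral Teichmüller powers -/

/-- `ω̃^{p−1} = 1` as a character `𝔽_pˣ → ℤ_pˣ`. [cite: Lang1990, Ch. 1 §2] -/
theorem teichmullerChar_pow_card_sub_one : Kato2004.teichmullerChar p ^ (p - 1) = 1 :=
  MonoidHom.ext fun a => by rw [MonoidHom.pow_apply, Kato2004.teichmullerChar_pow_sub_one, MonoidHom.one_apply]

/-- `ω̃^{i + j} = ω̃ⁱ ω̃ʲ` (pointwise `pow_add`, stated for the character to fix the instance path). [cite: Lang1990, Ch. 1 §2] -/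
theorem teichmullerChar_pow_add (i j : ℕ) :
    Kato2004.teichmullerChar p ^ (i + j) = Kato2004.teichmullerChar p ^ i * Kato2004.teichmullerChar p ^ j :=
  MonoidHom.ext fun a => by simp only [MonoidHom.pow_apply, MonoidHom.mul_apply, pow_add]

/-- `ω̃^{n(p−1) + t} = ω̃ᵗ`. [cite: Lang1990, Ch. 1 §2] -/
theorem teichmullerChar_pow_add_mul_card_sub_one (n t : ℕ) :
    Kato2004.teichmullerChar p ^ (n * (p - 1) + t) = Kato2004.teichmullerChar p ^ t :=
  MonoidHom.ext fun a => by
    simp only [MonoidHom.pow_apply, pow_add, pow_mul', Kato2004.teichmullerChar_pow_sub_one, one_pow, one_mul]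

omit hp in
/-- `MulChar.ofUnitHom` is multiplicative. [cite: IrelandRosen1990, Ch. 8 §1] -/
theorem ofUnitHom_mul_ofUnitHom {M R : Type*} [CommMonoidWithZero M] [CommRing R] (f g : Mˣ →* Rˣ) :
    MulChar.ofUnitHom f * MulChar.ofUnitHom g = MulChar.ofUnitHom (f * g) := by
  refine MulChar.ext fun a => ?_
  rw [MulChar.coeToFun_mul, Pi.mul_apply, MulChar.ofUnitHom_eq, MulChar.ofUnitHom_eq, MulChar.ofUnitHom_eq,
    MulChar.equivToUnitHom_symm_coe, MulChar.equivToUnitHom_symm_coe, MulChar.equivToUnitHom_symm_coe,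
    MonoidHom.mul_apply, Units.val_mul]

/-- Values of the integral Teichmüller power on units: `(ofUnitHom ω̃ᵗ)(a) = ω̃(a)ᵗ`. [cite: Lang1990, Ch. 1 §2] -/
theorem ofUnitHom_teichmullerChar_pow_apply (t : ℕ) (a : (ZMod p)ˣ) :
    MulChar.ofUnitHom (Kato2004.teichmullerChar p ^ t) (a : ZMod p) =
      ((Kato2004.teichmullerChar p a : ℤ_[p]ˣ) : ℤ_[p]) ^ t := by
  rw [MulChar.ofUnitHom_eq, MulChar.equivToUnitHom_symm_coe, MonoidHom.pow_apply, Units.val_pow_eq_pow_val]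

/-- **`ω̃(a)ᵗ ≡ aᵗ (mod p)`**: `‖ω̃(a)ᵗ − ãᵗ‖ < 1` in `ℤ_p` for the natural lift `ã = a.val`.
[cite: Lang1990, Ch. 1 §2] -/
theorem norm_teichmullerChar_pow_sub_natCast_pow_lt_one (t : ℕ) (a : (ZMod p)ˣ) :
    ‖((Kato2004.teichmullerChar p a : ℤ_[p]ˣ) : ℤ_[p]) ^ t - (((a : ZMod p).val : ℕ) : ℤ_[p]) ^ t‖ < 1 := by
  rw [← PadicInt.mem_nonunits, ← IsLocalRing.mem_maximalIdeal, ← PadicInt.ker_toZMod, RingHom.mem_ker, map_sub,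
    map_pow, map_pow, Kato2004.toZMod_teichmullerChar, map_natCast, ZMod.natCast_zmod_val, sub_self]

/-- The hypothesis shape of `norm_jacobiSum_eq_one_of_lt_add` for the `ℚ_p`-valued push-forward of the integral
Teichmüller power: `‖(ofUnitHom ω̃ᵗ)_ℚ(a) − ãᵗ‖ < 1` for `a ≠ 0`. [cite: Lang1990, Ch. 1 §2] -/
theorem norm_ringHomComp_ofUnitHom_teichmullerChar_pow_sub_lt_one (t : ℕ) (a : ZMod p) (ha : a ≠ 0) :
    ‖(MulChar.ofUnitHom (Kato2004.teichmullerChar p ^ t)).ringHomComp (PadicInt.Coe.ringHom (p := p)) a -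
        ((a.val : ℕ) : ℚ_[p]) ^ t‖ < 1 := by
  have hu : IsUnit a := isUnit_iff_ne_zero.mpr ha
  obtain ⟨u, rfl⟩ := hu
  rw [MulChar.ringHomComp_apply, ofUnitHom_teichmullerChar_pow_apply, PadicInt.Coe.ringHom_apply]
  have h := norm_teichmullerChar_pow_sub_natCast_pow_lt_one p t u
  rw [PadicInt.norm_def, PadicInt.coe_sub, PadicInt.coe_pow, PadicInt.coe_pow, PadicInt.coe_natCast] at h
  exact h

/-- **`ω̃ᵗ ≠ 1` for `0 < t < p − 1`** (`𝔽_pˣ` is cyclic of order `p − 1` and `ω̃` is faithful: reduce modulo `p`).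
[cite: Lang1990, Ch. 1 §2] -/
theorem teichmullerChar_pow_ne_one {t : ℕ} (ht : 0 < t) (ht' : t < p - 1) : Kato2004.teichmullerChar p ^ t ≠ 1 := by
  intro h
  obtain ⟨g, hg⟩ := IsCyclic.exists_ofOrder_eq_natCard (α := (ZMod p)ˣ)
  rw [Nat.card_eq_fintype_card, ZMod.card_units] at hg
  have hgt : g ^ t = 1 := by
    apply Kato2004.teichmullerChar_injective p
    rw [map_pow, map_one, ← MonoidHom.pow_apply, h, MonoidHom.one_apply]
  have hdvd : p - 1 ∣ t := hg ▸ orderOf_dvd_of_pow_eq_one hgt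
  exact absurd (Nat.le_of_dvd ht hdvd) (not_le.mpr ht')

/-- `ω̃ⁱ = ω̃ʲ` with `i, j < p − 1` forces `i = j`. [cite: Lang1990, Ch. 1 §2] -/
theorem teichmullerChar_pow_injOn {i j : ℕ} (hi : i < p - 1) (hj : j < p - 1)
    (h : Kato2004.teichmullerChar p ^ i = Kato2004.teichmullerChar p ^ j) : i = j := by
  -- pointwise in the group `ℤ_pˣ`
  have hpt : ∀ a : (ZMod p)ˣ, Kato2004.teichmullerChar p a ^ i = Kato2004.teichmullerChar p a ^ j := fun a => by
    rw [← MonoidHom.pow_apply, ← MonoidHom.pow_apply, h]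
  by_contra hne
  rcases Nat.lt_or_gt_of_ne hne with hlt | hlt
  · have h' : Kato2004.teichmullerChar p ^ (j - i) = 1 := MonoidHom.ext fun a => by
      rw [MonoidHom.pow_apply, MonoidHom.one_apply, pow_sub _ hlt.le, ← hpt a, mul_inv_cancel]
    exact teichmullerChar_pow_ne_one p (Nat.sub_pos_of_lt hlt) (by omega) h'
  · have h' : Kato2004.teichmullerChar p ^ (i - j) = 1 := MonoidHom.ext fun a => by
      rw [MonoidHom.pow_apply, MonoidHom.one_apply, pow_sub _ hlt.le, hpt a, mul_inv_cancel]
    exact teichmullerChar_pow_ne_one p (Nat.sub_pos_of_lt hlt) (by omega) h'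

/-- `ofUnitHom ω̃ⁱ = ofUnitHom ω̃ʲ` with `i, j < p − 1` forces `i = j`. [cite: Lang1990, Ch. 1 §2] -/
theorem ofUnitHom_teichmullerChar_pow_injOn {i j : ℕ} (hi : i < p - 1) (hj : j < p - 1)
    (h : MulChar.ofUnitHom (Kato2004.teichmullerChar p ^ i) = MulChar.ofUnitHom (Kato2004.teichmullerChar p ^ j)) :
    i = j := by
  refine teichmullerChar_pow_injOn p hi hj ?_
  rw [MulChar.ofUnitHom_eq, MulChar.ofUnitHom_eq] at h
  exact MulChar.equivToUnitHom.symm.injective h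

/-- `ofUnitHom ω̃ᵗ ≠ 1` for `0 < t < p − 1`. [cite: Lang1990, Ch. 1 §2] -/
theorem ofUnitHom_teichmullerChar_pow_ne_one {t : ℕ} (ht : 0 < t) (ht' : t < p - 1) :
    MulChar.ofUnitHom (Kato2004.teichmullerChar p ^ t) ≠ 1 := by
  intro h
  have h1 : MulChar.ofUnitHom (Kato2004.teichmullerChar p ^ t) = MulChar.ofUnitHom (Kato2004.teichmullerChar p ^ 0) := by
    rw [h, pow_zero]
    refine MulChar.ext fun a => ?_
    rw [MulChar.one_apply_coe, MulChar.ofUnitHom_eq, MulChar.equivToUnitHom_symm_coe, MonoidHom.one_apply,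
      Units.val_one]
  have hp2 := hp.out.two_le
  exact absurd (ofUnitHom_teichmullerChar_pow_injOn p ht' (by omega) h1) (by omega)

/-! ## Stickelberger's dichotomy read in `ℤ_p` -/

/-- **Unit half** (`a₁ + a₂ < p − 1` in Stickelberger's indexing): for `tᵢ ≤ p − 2` with `p − 1 < t₁ + t₂` the
Jacobi sum `J(ω̃^{t₁}, ω̃^{t₂}) ∈ ℤ_p` is a UNIT. [cite: Lang1990, Ch. 1 §2 Thm. 2.1] -/
theorem isUnit_jacobiSum_ofUnitHom_teichmullerChar_pow {t₁ t₂ : ℕ} (ht₁ : t₁ ≤ p - 2) (ht₂ : t₂ ≤ p - 2)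
    (hsum : p - 1 < t₁ + t₂) :
    IsUnit (jacobiSum (MulChar.ofUnitHom (Kato2004.teichmullerChar p ^ t₁))
      (MulChar.ofUnitHom (Kato2004.teichmullerChar p ^ t₂))) := by
  rw [PadicInt.isUnit_iff, PadicInt.norm_def, ← PadicInt.Coe.ringHom_apply, ← jacobiSum_ringHomComp]
  exact norm_jacobiSum_eq_one_of_lt_add ht₁ ht₂ hsum
    (fun a ha => norm_ringHomComp_ofUnitHom_teichmullerChar_pow_sub_lt_one p t₁ a ha)
    (fun a ha => norm_ringHomComp_ofUnitHom_teichmullerChar_pow_sub_lt_one p t₂ a ha)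

/-- **Valuation-one half** (`a₁ + a₂ > p − 1`): for `1 ≤ tᵢ`, `t₁ + t₂ < p − 1` the Jacobi sum
`J(ω̃^{t₁}, ω̃^{t₂}) ∈ ℤ_p` has `‖J‖ = p⁻¹`; in particular it is NOT a unit. [cite: Lang1990, Ch. 1 §2 Thm. 2.1] -/
theorem norm_jacobiSum_ofUnitHom_teichmullerChar_pow_eq_inv {t₁ t₂ : ℕ} (ht₁ : 1 ≤ t₁) (ht₂ : 1 ≤ t₂)
    (hsum : t₁ + t₂ < p - 1) :
    ‖jacobiSum (MulChar.ofUnitHom (Kato2004.teichmullerChar p ^ t₁))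
      (MulChar.ofUnitHom (Kato2004.teichmullerChar p ^ t₂))‖ = (p : ℝ)⁻¹ := by
  have hne : ∀ {t : ℕ}, 1 ≤ t → t < p - 1 →
      (MulChar.ofUnitHom (Kato2004.teichmullerChar p ^ t)).ringHomComp (PadicInt.Coe.ringHom (p := p)) ≠ 1 :=
    fun ht ht' => (MulChar.ringHomComp_ne_one_iff (f := PadicInt.Coe.ringHom (p := p))
      (fun _ _ hab => Subtype.ext hab)).mpr
      (ofUnitHom_teichmullerChar_pow_ne_one p ht ht')
  rw [PadicInt.norm_def, ← PadicInt.Coe.ringHom_apply, ← jacobiSum_ringHomComp]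
  refine norm_jacobiSum_eq_inv_of_add_lt ht₁ ht₂ hsum
    (fun a ha => norm_ringHomComp_ofUnitHom_teichmullerChar_pow_sub_lt_one p t₁ a ha)
    (fun a ha => norm_ringHomComp_ofUnitHom_teichmullerChar_pow_sub_lt_one p t₂ a ha)
    (hne ht₁ (by omega)) (hne ht₂ (by omega)) ?_
  rw [← MulChar.ringHomComp_mul, ofUnitHom_mul_ofUnitHom, ← teichmullerChar_pow_add]
  exact hne (by omega) hsum

/-- Non-unit form of the valuation-one half. [cite: Lang1990, Ch. 1 §2 Thm. 2.1] -/
theorem not_isUnit_jacobiSum_ofUnitHom_teichmullerChar_pow {t₁ t₂ : ℕ} (ht₁ : 1 ≤ t₁) (ht₂ : 1 ≤ t₂)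
    (hsum : t₁ + t₂ < p - 1) :
    ¬ IsUnit (jacobiSum (MulChar.ofUnitHom (Kato2004.teichmullerChar p ^ t₁))
      (MulChar.ofUnitHom (Kato2004.teichmullerChar p ^ t₂))) := by
  rw [PadicInt.isUnit_iff, norm_jacobiSum_ofUnitHom_teichmullerChar_pow_eq_inv p ht₁ ht₂ hsum]
  have hp1 : (1 : ℝ) < p := by exact_mod_cast hp.out.one_lt
  exact ne_of_lt (inv_lt_one_of_one_lt₀ hp1)

/-! ## The quadratic character `ω̃^{(p−1)/2}` and the twisting exponents `b ± (p−1)/2` -/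

/-- The quadratic Teichmüller power is an involution: `(ω̃^{(p−1)/2})⁻¹ = ω̃^{(p−1)/2}` as `ℤ_p`-valued characters
of `𝔽_p` (`p` odd). [cite: Lang1990, Ch. 1 §2] -/
theorem ofUnitHom_teichmullerChar_pow_half_inv (hp2 : p ≠ 2) :
    (MulChar.ofUnitHom (Kato2004.teichmullerChar p ^ ((p - 1) / 2)))⁻¹ =
      MulChar.ofUnitHom (Kato2004.teichmullerChar p ^ ((p - 1) / 2)) := by
  have heven : 2 * ((p - 1) / 2) = p - 1 := Nat.two_mul_div_two_of_even (hp.out.even_sub_one hp2)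
  have hsq : MulChar.ofUnitHom (Kato2004.teichmullerChar p ^ ((p - 1) / 2)) *
      MulChar.ofUnitHom (Kato2004.teichmullerChar p ^ ((p - 1) / 2)) = 1 := by
    rw [ofUnitHom_mul_ofUnitHom, ← teichmullerChar_pow_add, ← two_mul, heven, teichmullerChar_pow_card_sub_one]
    refine MulChar.ext fun a => ?_
    rw [MulChar.one_apply_coe, MulChar.ofUnitHom_eq, MulChar.equivToUnitHom_symm_coe, MonoidHom.one_apply,
      Units.val_one]
  exact inv_eq_of_mul_eq_one_left hsq

/-- **The UNSTARRED exponent gives a unit**: for `0 < b` with `2b < p − 1` (`p` odd) the Jacobi sum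
`J(ω̃ᵇ · ω̃^{(p−1)/2}, ω̃^{(p−1)/2}) = J(ω̃^{b + (p−1)/2}, ω̃^{(p−1)/2})` is a unit of `ℤ_p` (Stickelberger: the exponents
sum to `b + (p − 1) > p − 1`).  This is the coefficient of the twisting operator `Σ_a χ(a)u(a)` (`χ` quadratic)
between the torus lines of the tame type `Ind(ω̃⁻ᵇ ⊗ ω̃ᵇ)` (`Literature/RepresentationTheory/FiniteGroups/
GL2ModularPrincipalSeriesLatticeTwistIndex`). [cite: Lang1990, Ch. 1 §2 Thm. 2.1] -/
theorem isUnit_jacobiSum_teichmuller_quadratic_of_two_mul_lt (hp2 : p ≠ 2) {b : ℕ} (hb : 0 < b)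
    (hb2 : 2 * b < p - 1) :
    IsUnit (jacobiSum
      (MulChar.ofUnitHom (Kato2004.teichmullerChar p ^ b) * MulChar.ofUnitHom (Kato2004.teichmullerChar p ^ ((p - 1) / 2)))
      (MulChar.ofUnitHom (Kato2004.teichmullerChar p ^ ((p - 1) / 2)))) := by
  have heven : 2 * ((p - 1) / 2) = p - 1 := Nat.two_mul_div_two_of_even (hp.out.even_sub_one hp2)
  rw [ofUnitHom_mul_ofUnitHom, ← teichmullerChar_pow_add]
  exact isUnit_jacobiSum_ofUnitHom_teichmullerChar_pow p (by omega) (by omega) (by omega)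

/-- **The STARRED exponent gives a non-unit**: for `p − 1 < 2b`, `b < p − 1` the Jacobi sum
`J(ω̃ᵇ · ω̃^{(p−1)/2}, ω̃^{(p−1)/2}) = J(ω̃^{b − (p−1)/2}, ω̃^{(p−1)/2})` has norm `p⁻¹` (exponents sum to `b < p − 1`).
[cite: Lang1990, Ch. 1 §2 Thm. 2.1] -/
theorem not_isUnit_jacobiSum_teichmuller_quadratic_of_lt_two_mul (hp2 : p ≠ 2) {b : ℕ} (hb : p - 1 < 2 * b)
    (hb' : b < p - 1) :
    ¬ IsUnit (jacobiSum
      (MulChar.ofUnitHom (Kato2004.teichmullerChar p ^ b) * MulChar.ofUnitHom (Kato2004.teichmullerChar p ^ ((p - 1) / 2)))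
      (MulChar.ofUnitHom (Kato2004.teichmullerChar p ^ ((p - 1) / 2)))) := by
  have heven : 2 * ((p - 1) / 2) = p - 1 := Nat.two_mul_div_two_of_even (hp.out.even_sub_one hp2)
  rw [ofUnitHom_mul_ofUnitHom, ← teichmullerChar_pow_add,
    show b + (p - 1) / 2 = 1 * (p - 1) + (b - (p - 1) / 2) by omega, teichmullerChar_pow_add_mul_card_sub_one]
  exact not_isUnit_jacobiSum_ofUnitHom_teichmullerChar_pow p (by omega) (by omega) (by omega)

end Literature.NumberTheory.GaussSums
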